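import Literature.Analysis.FunctionSpaces.PolchinskiFamilyDerivative
import Mathlib.Probability.Distributions.Gaussian.Fernique
import HarnessLib

/-!
# Differentiating fluctuation averages of a time-dependent family with a TEMPERED slope remainder
# (toolkit for Bauerschmidt–Bodineau–Dagallier §3.2–3.3, unbounded renormalised potentials)

Topic `Literature/Analysis/FunctionSpaces`; "proof architecture" file behind the named fact
`Polchinski.BauerschmidtBodineau_multiscaleBakryEmery` ([BBD] Theorem 3, `MultiscaleBakryEmery.lean`).

`PolchinskiFamilyDerivative.lean` differentiates `s ↦ E_{C_∞−C_s}[K_s(φ+·)]` for a family `K_s` whose time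
slope at `s = t` is UNIFORM in space: `|K_s(y) − K_t(y) − (s−t)K̇(y)| ≤ ε|s−t|` for all `y` simultaneously.
When the initial potential `V₀` of the Polchinski flow is unbounded above (the printed generality of
[BBD] Theorem 3 / [BB21] Theorem 5: `V₀ : ℝ^N → ℝ` with `e^{−V₀}` integrable), the families of the proof of
Theorem 3 — `e^{−V_t}Φ(P_{0,t}F)` and `e^{−V_t}(∇√P_{0,t}F)²_{Ċ_t}` — are still `C_b²` in space with a bounded
slope `K̇`, but the slope remainder is only controlled with a weight growing in `y`: `1/Z_t(y) = e^{+V_t(y)}`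
enters, and `Z_t(y) ≳ e^{−c‖y‖²}`.  This file proves the rule of `PolchinskiFamilyDerivative.lean` under the
weaker hypothesis

  for every `a > 0` and `ε > 0`, eventually as `s → t`:  `|K_s(y) − K_t(y) − (s−t)K̇(y)| ≤ ε|s−t|·e^{a‖y‖²}`
  for all `y`,

using the square-exponential moments of the fluctuation Gaussians `P_{C_∞−C_s}` (Fernique's theorem for the
standard Gaussian, Mathlib `IsGaussian.exists_integrable_exp_sq`, transported along `P_S = (√S)_* P_{Id}`,
with a rate uniform for `s` near `t`).

## Main results (sorry-free; no new definitions, no new named facts)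

* `exists_integral_exp_mul_norm_sq_gaussian_le` — ∃ `c > 0`, `B`: for every positive semidefinite `S`
  and `0 ≤ a` with `a·Σ|S_{ij}| ≤ c`, `e^{a‖w‖²}` is `P_S`-integrable with `E_S[e^{a‖w‖²}] ≤ B`.
* **`hasDerivAt_integral_family_Cinf_sub_of_sqExp`** — for `K_t ∈ C_b²` (bounded, bounded uniformly
  continuous Hessian), `K_s` uniformly bounded and continuous, `K̇` bounded uniformly continuous, and the
  tempered slope hypothesis displayed above:
  `d/ds E_{C_∞−C_s}[K_s(φ+·)] |_{s=t} = −½ Σ Ċ_t^{ij} E_{C_∞−C_t}[∂_i∂_jK_t(φ+·)] + E_{C_∞−C_t}[K̇(φ+·)]`.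

Nothing here concerns Yang–Mills.

## References

* [BauerschmidtBodineauDagallier2023] R. Bauerschmidt, T. Bodineau, B. Dagallier, Probab. Surveys 21
  (2024) 200–290, arXiv:2307.07619 — Prop 5 p0014, Prop 8 proof p0015, Thm 3 proof p0016. READ (held).
* [BauerschmidtBodineau2021SineGordonLSI] R. Bauerschmidt, T. Bodineau, CPAM 74 (2021), §2.1–2.3
  (`paper:arxiv-1907.12308` p0008–p0010: the potential `V₀ : ℝ^N → ℝ` carries no growth restriction). READ.
* [DapratoZabczyk1992] G. Da Prato, J. Zabczyk, *Stochastic Equations in Infinite Dimensions*, CUP 1992 —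
  §2.2.1 Theorem 2.7 p.37 (Fernique). READ (held text `book:da-prato1992-stochastic-equations-infinite-dimensions`
  p0085).
-/

noncomputable section

-- nested operator-norm instances `E →L[ℝ] E →L[ℝ] ℝ`
set_option maxSynthPendingDepth 2

open MeasureTheory ProbabilityTheory Filter Topology Set Asymptotics
open scoped RealInnerProductSpace Matrix MatrixOrder

namespace Literature.Analysis.FunctionSpaces

namespace Polchinski

variable {N : ℕ}

/-! ### Square-exponential Gaussian moments, uniformly in the covariance -/

section GaussMoments

variable {ι : Type*} [Fintype ι] [DecidableEq ι]

omit [DecidableEq ι] in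
/-- The quadratic form of a real matrix is dominated by `(Σ_{ij} |S_{ij}|) ‖z‖²`. [folklore] -/
private theorem dotProduct_mulVec_le_sum_abs_mul_norm_sq' (S : Matrix ι ι ℝ) (z : EuclideanSpace ℝ ι) :
    WithLp.ofLp z ⬝ᵥ S *ᵥ WithLp.ofLp z ≤ (∑ i, ∑ j, |S i j|) * ‖z‖ ^ 2 := by
  have hz : ∀ i, |z i| ≤ ‖z‖ := fun i => by
    simpa [Real.norm_eq_abs] using PiLp.norm_apply_le z i
  simp only [dotProduct, Matrix.mulVec, Finset.mul_sum, Finset.sum_mul]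
  refine Finset.sum_le_sum fun i _ => Finset.sum_le_sum fun j _ => ?_
  have h1 : WithLp.ofLp z i * (S i j * WithLp.ofLp z j) = S i j * (z i * z j) := by ring
  rw [h1]
  calc S i j * (z i * z j) ≤ |S i j * (z i * z j)| := le_abs_self _
    _ = |S i j| * (|z i| * |z j|) := by rw [abs_mul, abs_mul]
    _ ≤ |S i j| * (‖z‖ * ‖z‖) := by
        gcongr
        exacts [hz i, hz j]
    _ = |S i j| * ‖z‖ ^ 2 := by ring

/-- `‖√S z‖² = (z, S z)` for positive semidefinite `S`. [folklore] -/
private theorem norm_sqrt_apply_sq₃ {S : Matrix ι ι ℝ} (hS : S.PosSemidef) (z : EuclideanSpace ℝ ι) :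
    ‖Matrix.toEuclideanCLM (𝕜 := ℝ) (CFC.sqrt S) z‖ ^ 2 = WithLp.ofLp z ⬝ᵥ S *ᵥ WithLp.ofLp z := by
  set T := Matrix.toEuclideanCLM (𝕜 := ℝ) (CFC.sqrt S) with hT
  have hsa : IsSelfAdjoint T := (CFC.sqrt_nonneg S).isSelfAdjoint.map _
  rw [← real_inner_self_eq_norm_sq, ← ContinuousLinearMap.adjoint_inner_right, hsa.adjoint_eq,
    ← ContinuousLinearMap.comp_apply, ← ContinuousLinearMap.mul_def, hT, ← map_mul,
    CFC.sqrt_mul_sqrt_self _ hS.nonneg, Matrix.inner_toEuclideanCLM]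

/-- **Square-exponential moments of centred Gaussians, uniformly in the covariance** (Fernique): there
are `c > 0` and `B` such that for every positive semidefinite `S` and every `0 ≤ a` with
`a · Σ_{ij}|S_{ij}| ≤ c`, the function `w ↦ e^{a‖w‖²}` is `P_S`-integrable and `E_S[e^{a‖w‖²}] ≤ B`
(`P_S = (√S)_* P_{Id}` and `‖√S z‖² ≤ (Σ|S_{ij}|)‖z‖²`; Fernique's theorem, Da Prato–Zabczyk Thm 2.7 p.37:
`∫ e^{λ‖x‖²} dμ < ∞` for a centred Gaussian `μ` and small `λ > 0` — here Mathlib's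
`IsGaussian.exists_integrable_exp_sq` for the standard Gaussian). [cite: DapratoZabczyk1992, Theorem 2.7] -/
theorem exists_integral_exp_mul_norm_sq_gaussian_le :
    ∃ c : ℝ, 0 < c ∧ ∃ B : ℝ, ∀ (S : Matrix ι ι ℝ), S.PosSemidef → ∀ a : ℝ, 0 ≤ a →
      a * (∑ i, ∑ j, |S i j|) ≤ c →
        Integrable (fun w => Real.exp (a * ‖w‖ ^ 2)) (multivariateGaussian 0 S) ∧
          ∫ w, Real.exp (a * ‖w‖ ^ 2) ∂(multivariateGaussian 0 S) ≤ B := by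
  obtain ⟨c, hc, hint⟩ := IsGaussian.exists_integrable_exp_sq (stdGaussian (EuclideanSpace ℝ ι))
  refine ⟨c, hc, ∫ z, Real.exp (c * ‖z‖ ^ 2) ∂(stdGaussian (EuclideanSpace ℝ ι)),
    fun S hS a ha hac => ?_⟩
  set T := Matrix.toEuclideanCLM (𝕜 := ℝ) (CFC.sqrt S) with hT
  have hmeas : AEMeasurable (fun x : EuclideanSpace ℝ ι => (0 : EuclideanSpace ℝ ι) + T x)
      (stdGaussian (EuclideanSpace ℝ ι)) := by fun_prop
  -- pointwise domination of the transported integrand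
  have hdom : ∀ z : EuclideanSpace ℝ ι,
      Real.exp (a * ‖(0 : EuclideanSpace ℝ ι) + T z‖ ^ 2) ≤ Real.exp (c * ‖z‖ ^ 2) := by
    intro z
    rw [zero_add, Real.exp_le_exp]
    have hsq : ‖T z‖ ^ 2 ≤ (∑ i, ∑ j, |S i j|) * ‖z‖ ^ 2 := by
      rw [hT, norm_sqrt_apply_sq₃ hS z]
      exact dotProduct_mulVec_le_sum_abs_mul_norm_sq' S z
    calc a * ‖T z‖ ^ 2 ≤ a * ((∑ i, ∑ j, |S i j|) * ‖z‖ ^ 2) :=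
          mul_le_mul_of_nonneg_left hsq ha
      _ = (a * ∑ i, ∑ j, |S i j|) * ‖z‖ ^ 2 := by ring
      _ ≤ c * ‖z‖ ^ 2 := mul_le_mul_of_nonneg_right hac (by positivity)
  have hcomp : Integrable (fun z : EuclideanSpace ℝ ι =>
      Real.exp (a * ‖(0 : EuclideanSpace ℝ ι) + T z‖ ^ 2)) (stdGaussian (EuclideanSpace ℝ ι)) := by
    refine Integrable.mono' hint (by fun_prop) (Eventually.of_forall fun z => ?_)
    rw [Real.norm_eq_abs, abs_of_pos (Real.exp_pos _)]
    exact hdom z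
  constructor
  · rw [multivariateGaussian, ← hT]
    exact (integrable_map_measure (by fun_prop) hmeas).2 hcomp
  · rw [multivariateGaussian, ← hT, integral_map hmeas (by fun_prop)]
    exact integral_mono hcomp hint hdom

end GaussMoments

/-! ### The differentiation rule with a tempered slope remainder -/

section Family

variable (D : CovDecomposition N)

/-- `‖φ + x‖² ≤ 2‖φ‖² + 2‖x‖²`. [folklore] -/
private theorem norm_add_sq_le_two (φ x : EuclideanSpace ℝ (Fin N)) :
    ‖φ + x‖ ^ 2 ≤ 2 * ‖φ‖ ^ 2 + 2 * ‖x‖ ^ 2 := by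
  have h := norm_add_le φ x
  nlinarith [norm_nonneg φ, norm_nonneg x, norm_nonneg (φ + x), sq_nonneg (‖φ‖ - ‖x‖)]

/-- **Differentiating `s ↦ E_{C_∞−C_s}[K_s(φ+·)]` for a time-dependent family with a tempered slope
remainder** ([BBD] proof of Theorem 3, «both `ν_t` and `F_t` vary with `t`», in the generality of an initial
potential unbounded above): let `K_t ∈ C_b²` with bounded, uniformly continuous Hessian `D2K`, let the `K_s`
be continuous and uniformly bounded, let `K̇ = Kd` be bounded and uniformly continuous, and assume that for
every `a > 0` and `ε > 0`, eventually as `s → t`, `|K_s(y) − K_t(y) − (s−t)K̇(y)| ≤ ε|s−t|e^{a‖y‖²}` for all `y`.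
Then `d/ds|_{s=t} E_{C_∞−C_s}[K_s(φ+·)] = −½ Σ Ċ_t^{ij} E_{C_∞−C_t}[∂_i∂_jK_t(φ+·)] + E_{C_∞−C_t}[K̇(φ+·)]`
(the case of a uniform remainder is `hasDerivAt_integral_family_Cinf_sub`).
[cite: BauerschmidtBodineauDagallier2023, Theorem 3 (proof)] -/
theorem hasDerivAt_integral_family_Cinf_sub_of_sqExp (K : ℝ → EuclideanSpace ℝ (Fin N) → ℝ)
    {DK : EuclideanSpace ℝ (Fin N) → EuclideanSpace ℝ (Fin N) →L[ℝ] ℝ}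
    {D2K : EuclideanSpace ℝ (Fin N) → EuclideanSpace ℝ (Fin N) →L[ℝ] EuclideanSpace ℝ (Fin N) →L[ℝ] ℝ}
    (Kd : EuclideanSpace ℝ (Fin N) → ℝ) {t : ℝ} (ht : 0 < t)
    (h1 : ∀ y, HasFDerivAt (K t) (DK y) y) (h2 : ∀ y, HasFDerivAt DK (D2K y) y)
    (hKc : ∀ s, Continuous (K s)) {K0 : ℝ} (hKb : ∀ s y, |K s y| ≤ K0)
    {MK : ℝ} (hMK : ∀ y, ‖D2K y‖ ≤ MK) (hUCK : UniformContinuous D2K)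
    (hKdc : Continuous Kd) {Kd0 : ℝ} (hKdb : ∀ y, |Kd y| ≤ Kd0) (hKduc : UniformContinuous Kd)
    (hU : ∀ a : ℝ, 0 < a → ∀ ε : ℝ, 0 < ε → ∀ᶠ s in 𝓝 t, ∀ y : EuclideanSpace ℝ (Fin N),
      |K s y - K t y - (s - t) * Kd y| ≤ ε * |s - t| * Real.exp (a * ‖y‖ ^ 2))
    (φ : EuclideanSpace ℝ (Fin N)) :
    HasDerivAt (fun s => ∫ x, K s (φ + x) ∂(multivariateGaussian 0 (D.Cinf - D.C s)))
      (-((1 / 2) * ∑ i, ∑ j, D.Cdot t i j *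
          ∫ x, D2K (φ + x) (EuclideanSpace.single i 1) (EuclideanSpace.single j 1)
            ∂(multivariateGaussian 0 (D.Cinf - D.C t))) +
        ∫ x, Kd (φ + x) ∂(multivariateGaussian 0 (D.Cinf - D.C t))) t := by
  -- (0) the square-exponential rate, uniform for `s` near `t`
  obtain ⟨c, hc, B, hB⟩ := exists_integral_exp_mul_norm_sq_gaussian_le (ι := Fin N)
  set L : ℝ := (∑ i, ∑ j, |(D.Cinf - D.C t) i j|) + 1 with hL
  have hL0 : 0 < L := by positivity
  have evL : ∀ᶠ s in 𝓝 t, (∑ i, ∑ j, |(D.Cinf - D.C s) i j|) ≤ L := by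
    have hcont : ∀ i j, Tendsto (fun s => |(D.Cinf - D.C s) i j|) (𝓝 t)
        (𝓝 |(D.Cinf - D.C t) i j|) := by
      intro i j
      simp only [Matrix.sub_apply]
      exact ((D.hasDerivAt_C t ht.le i j).continuousAt.tendsto.const_sub (D.Cinf i j)).abs
    have hsum : Tendsto (fun s => ∑ i, ∑ j, |(D.Cinf - D.C s) i j|) (𝓝 t)
        (𝓝 (∑ i, ∑ j, |(D.Cinf - D.C t) i j|)) :=
      tendsto_finsetSum _ fun i _ => tendsto_finsetSum _ fun j _ => hcont i j
    have hlt : (∑ i, ∑ j, |(D.Cinf - D.C t) i j|) < L := by rw [hL]; linarith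
    exact ((tendsto_order.1 hsum).2 L hlt).mono fun s hs => hs.le
  have evPos' : ∀ᶠ s in 𝓝 t, 0 < s := isOpen_Ioi.mem_nhds ht
  have evPos : ∀ᶠ s in 𝓝 t, 0 ≤ s := evPos'.mono fun s hs => hs.le
  set a : ℝ := c / (4 * L) with ha
  have ha0 : 0 < a := by positivity
  have h2aL : (2 * a) * L ≤ c := by
    rw [ha]
    field_simp
    nlinarith
  -- the weight `e^{a‖φ + x‖²} ≤ e^{2a‖φ‖²} e^{2a‖x‖²}` and its uniform integral bound
  set Bφ : ℝ := Real.exp (2 * a * ‖φ‖ ^ 2) * B with hBφ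
  have hW : ∀ᶠ s in 𝓝 t,
      Integrable (fun x => Real.exp (a * ‖φ + x‖ ^ 2)) (multivariateGaussian 0 (D.Cinf - D.C s)) ∧
        ∫ x, Real.exp (a * ‖φ + x‖ ^ 2) ∂(multivariateGaussian 0 (D.Cinf - D.C s)) ≤ Bφ := by
    filter_upwards [evL, evPos] with s hsL hs0
    have hS := D.posSemidef_Cinf_sub hs0
    have hrate : (2 * a) * (∑ i, ∑ j, |(D.Cinf - D.C s) i j|) ≤ c :=
      (mul_le_mul_of_nonneg_left hsL (by positivity)).trans h2aL
    obtain ⟨hI, hIB⟩ := hB (D.Cinf - D.C s) hS (2 * a) (by positivity) hrate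
    have hpt : ∀ x : EuclideanSpace ℝ (Fin N), Real.exp (a * ‖φ + x‖ ^ 2) ≤
        Real.exp (2 * a * ‖φ‖ ^ 2) * Real.exp (2 * a * ‖x‖ ^ 2) := by
      intro x
      rw [← Real.exp_add, Real.exp_le_exp]
      have h := norm_add_sq_le_two φ x
      nlinarith [ha0.le]
    have hI' : Integrable (fun x => Real.exp (a * ‖φ + x‖ ^ 2))
        (multivariateGaussian 0 (D.Cinf - D.C s)) := by
      refine Integrable.mono' (hI.const_mul (Real.exp (2 * a * ‖φ‖ ^ 2))) (by fun_prop)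
        (Eventually.of_forall fun x => ?_)
      rw [Real.norm_eq_abs, abs_of_pos (Real.exp_pos _)]
      exact hpt x
    refine ⟨hI', ?_⟩
    calc ∫ x, Real.exp (a * ‖φ + x‖ ^ 2) ∂(multivariateGaussian 0 (D.Cinf - D.C s))
        ≤ ∫ x, Real.exp (2 * a * ‖φ‖ ^ 2) * Real.exp (2 * a * ‖x‖ ^ 2)
            ∂(multivariateGaussian 0 (D.Cinf - D.C s)) :=
          integral_mono hI' (hI.const_mul _) hpt
      _ = Real.exp (2 * a * ‖φ‖ ^ 2) *
            ∫ x, Real.exp (2 * a * ‖x‖ ^ 2) ∂(multivariateGaussian 0 (D.Cinf - D.C s)) :=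
          integral_const_mul _ _
      _ ≤ Bφ := by
          rw [hBφ]
          exact mul_le_mul_of_nonneg_left hIB (Real.exp_pos _).le
  have hBφ0 : 0 ≤ Bφ := by
    obtain ⟨s, hsI, hsB⟩ := hW.exists
    exact le_trans (integral_nonneg fun x => (Real.exp_pos _).le) hsB
  -- (1) covariance part: fixed integrand `K_t`, moving covariance `C_∞ − C_s`
  have hv := hasDerivAt_integral_gaussian_Cinf_sub D h1 h2 (hKb t) hMK hUCK ht φ
  -- integrable pieces over a probability measure
  have hInt : ∀ (G : EuclideanSpace ℝ (Fin N) → ℝ), Continuous G → ∀ C : ℝ, (∀ y, |G y| ≤ C) →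
      ∀ (P : Measure (EuclideanSpace ℝ (Fin N))) [IsProbabilityMeasure P],
        Integrable (fun x => G (φ + x)) P := by
    intro G hGc C hGC P _
    exact Integrable.of_bound (hGc.comp (continuous_const.add continuous_id)).aestronglyMeasurable C
      (Eventually.of_forall fun x => by rw [Real.norm_eq_abs]; exact hGC (φ + x))
  -- (2) the slope decomposition `u = v + (u − v)`
  set u : ℝ → ℝ := fun s => ∫ x, K s (φ + x) ∂(multivariateGaussian 0 (D.Cinf - D.C s)) with hu
  set v : ℝ → ℝ := fun s => ∫ x, K t (φ + x) ∂(multivariateGaussian 0 (D.Cinf - D.C s)) with hvdef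
  set W : ℝ := ∫ x, Kd (φ + x) ∂(multivariateGaussian 0 (D.Cinf - D.C t)) with hWdef
  have huv : ∀ s, u s - v s = ∫ x, (K s (φ + x) - K t (φ + x))
      ∂(multivariateGaussian 0 (D.Cinf - D.C s)) := by
    intro s
    rw [hu, hvdef]
    exact (integral_sub (hInt (K s) (hKc s) K0 (hKb s) _) (hInt (K t) (hKc t) K0 (hKb t) _)).symm
  have hut : u t = v t := by rw [hu, hvdef]
  rw [hasDerivAt_iff_tendsto_slope]
  have hvs := hasDerivAt_iff_tendsto_slope.mp hv
  have hslope : ∀ s, slope u t s = slope v t s + (s - t)⁻¹ * (u s - v s) := by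
    intro s
    rw [slope_def_field, slope_def_field, hut]
    ring
  -- (3) the integrand part: `(s−t)⁻¹ (u s − v s) → W`
  have hX : Tendsto (fun s => (s - t)⁻¹ * (u s - v s)) (𝓝[≠] t) (𝓝 W) := by
    have hcont : Tendsto (fun s => ∫ x, Kd (φ + x) ∂(multivariateGaussian 0 (D.Cinf - D.C s)))
        (𝓝[≠] t) (𝓝 W) := by
      have h := tendsto_integral_gaussian_Cinf_sub_Ici D hKdc.measurable hKdb hKduc ht.le φ
      rw [nhdsWithin_eq_nhds.2 (Ici_mem_nhds ht)] at h
      exact h.mono_left nhdsWithin_le_nhds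
    rw [Metric.tendsto_nhds]
    intro ε hε
    set ε' : ℝ := ε / (4 * (Bφ + 1)) with hε'
    have hε'0 : 0 < ε' := by positivity
    have ev1 := (hU a ha0 ε' hε'0).filter_mono (nhdsWithin_le_nhds (s := ({t}ᶜ : Set ℝ)) (a := t))
    have ev2 := Metric.tendsto_nhds.mp hcont _ (half_pos hε)
    have ev3 : ∀ᶠ s in 𝓝[≠] t, s ≠ t := self_mem_nhdsWithin
    have ev4 := hW.filter_mono (nhdsWithin_le_nhds (s := ({t}ᶜ : Set ℝ)) (a := t))
    filter_upwards [ev1, ev2, ev3, ev4] with s hs1 hs2 hs3 hs4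
    obtain ⟨hWI, hWB⟩ := hs4
    have hst : s - t ≠ 0 := sub_ne_zero.2 hs3
    rw [huv s, ← integral_const_mul, Real.dist_eq]
    rw [Real.dist_eq] at hs2
    have hI1 : Integrable (fun x => (s - t)⁻¹ * (K s (φ + x) - K t (φ + x)))
        (multivariateGaussian 0 (D.Cinf - D.C s)) :=
      hInt (fun y => (s - t)⁻¹ * (K s y - K t y)) (continuous_const.mul ((hKc s).sub (hKc t)))
        (|(s - t)⁻¹| * (K0 + K0)) (fun y => by
          rw [abs_mul]
          refine mul_le_mul_of_nonneg_left ?_ (abs_nonneg _)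
          exact (abs_sub _ _).trans (add_le_add (hKb s y) (hKb t y))) _
    have hI2 : Integrable (fun x => Kd (φ + x)) (multivariateGaussian 0 (D.Cinf - D.C s)) :=
      hInt Kd hKdc Kd0 hKdb _
    have hpt : ∀ x, |(s - t)⁻¹ * (K s (φ + x) - K t (φ + x)) - Kd (φ + x)| ≤
        ε' * Real.exp (a * ‖φ + x‖ ^ 2) := by
      intro x
      have h1 := hs1 (φ + x)
      have hid : (s - t)⁻¹ * (K s (φ + x) - K t (φ + x)) - Kd (φ + x) =
          (s - t)⁻¹ * (K s (φ + x) - K t (φ + x) - (s - t) * Kd (φ + x)) := by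
        field_simp
      rw [hid, abs_mul, abs_inv]
      calc |s - t|⁻¹ * |K s (φ + x) - K t (φ + x) - (s - t) * Kd (φ + x)|
          ≤ |s - t|⁻¹ * (ε' * |s - t| * Real.exp (a * ‖φ + x‖ ^ 2)) :=
            mul_le_mul_of_nonneg_left h1 (inv_nonneg.2 (abs_nonneg _))
        _ = ε' * Real.exp (a * ‖φ + x‖ ^ 2) := by
            have hane : |s - t| ≠ 0 := abs_ne_zero.2 hst
            field_simp
    have hT1 : |(∫ x, (s - t)⁻¹ * (K s (φ + x) - K t (φ + x)) ∂(multivariateGaussian 0 (D.Cinf - D.C s))) -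
        ∫ x, Kd (φ + x) ∂(multivariateGaussian 0 (D.Cinf - D.C s))| ≤ ε / 4 := by
      rw [← integral_sub hI1 hI2]
      calc |∫ x, ((s - t)⁻¹ * (K s (φ + x) - K t (φ + x)) - Kd (φ + x))
              ∂(multivariateGaussian 0 (D.Cinf - D.C s))|
          ≤ ∫ x, |(s - t)⁻¹ * (K s (φ + x) - K t (φ + x)) - Kd (φ + x)|
              ∂(multivariateGaussian 0 (D.Cinf - D.C s)) := abs_integral_le_integral_abs
        _ ≤ ∫ x, ε' * Real.exp (a * ‖φ + x‖ ^ 2) ∂(multivariateGaussian 0 (D.Cinf - D.C s)) :=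
            integral_mono_of_nonneg (Eventually.of_forall fun x => abs_nonneg _)
              (hWI.const_mul ε') (Eventually.of_forall hpt)
        _ = ε' * ∫ x, Real.exp (a * ‖φ + x‖ ^ 2) ∂(multivariateGaussian 0 (D.Cinf - D.C s)) :=
            integral_const_mul _ _
        _ ≤ ε' * Bφ := mul_le_mul_of_nonneg_left hWB hε'0.le
        _ ≤ ε / 4 := by
            rw [hε', div_mul_eq_mul_div, div_le_div_iff₀ (by positivity) (by norm_num)]
            nlinarith [hBφ0, hε.le]
    calc _ ≤ |(∫ x, (s - t)⁻¹ * (K s (φ + x) - K t (φ + x)) ∂(multivariateGaussian 0 (D.Cinf - D.C s))) -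
            ∫ x, Kd (φ + x) ∂(multivariateGaussian 0 (D.Cinf - D.C s))| +
          |(∫ x, Kd (φ + x) ∂(multivariateGaussian 0 (D.Cinf - D.C s))) - W| := abs_sub_le _ _ _
      _ < ε / 4 + ε / 2 := add_lt_add_of_le_of_lt hT1 hs2
      _ < ε := by linarith
  refine (hvs.add hX).congr' ?_
  exact Eventually.of_forall fun s => (hslope s).symm

end Family

end Polchinski

end Literature.Analysis.FunctionSpaces

end
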